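import Mathlib
import HarnessLib
import Literature.NumberTheory.Sieve.BatemanHorn
import Literature.NumberTheory.Sieve.BatemanHornProofs
import Literature.NumberTheory.LFunctions.HallTenenbaumTheorem01
import Literature.NumberTheory.LFunctions.MertensElementary
import Summits.Parity.BatemanHorn.Theorems.AlmostPrimeZerosLinearCappedRepulsionRankinMajorant

/-!
# Far moment along a system — the linear case (helper for stub `stub_farMoment`, S1)

Line `smooth-rough-lattice-acquisition` of crux stmt-Parity-11291
(`Summit.Parity.BatemanHorn.Theses.AlmostPrimeZeros.SystemZeroRepulsion`), stub S1
(`stub_farMoment` = `FarMomentAlongSystem`), restricted to the systems for which it is a theorem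
today: `k ≤ 1` and `deg f₀ ≤ 1`.

For `s(m) = Σ_{p^v ∥ m} min(v, 2)` (`m.factorization.sum fun _ v => min v 2`, `s(0) = s(1) = 0`),
a Bateman–Horn system `f` with `k ≤ 1` members, all of degree `≤ 1`, and the capped statistic
`s_f(n) = Σ_i s((f_i(n))⁺)`, there is `C = C_f` with
`Σ_{0 ≤ n ≤ x} t^{s_f(n)} ≤ (x + 1)·exp(C·t·log log x)` for ALL `x ≥ 3` and ALL real `t ≥ 1`
(no upper constraint on the tilt `t`; the registered S1 asks only `t ≤ √log x`).

Proof.  `k = 0`: the sum is `x + 1`.  `k = 1`: `f₀ = aX + b` with `a > 0`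
(`IsBatemanHornSystem.leadingCoeff_pos`, `natDegree_pos`); `n ↦ a n + b` is injective and maps
`{n ≤ x : a n + b > 0}` into `[1, (a + |b|)x]`, the other `n` contribute `t^{s(0)} = 1` each, so
`Σ_{n ≤ x} t^{s_f(n)} ≤ (x+1) + Σ_{1 ≤ m ≤ (a+|b|)x} t^{s(m)}`.  Rankin's trick with `σ = 1`
(Hall–Tenenbaum (0.4), tree `HallTenenbaum.sum_div_le_prod_tsum`; local factor `≤ e^{2t/p}`, tree
`tsum_localFactor_le`; Mertens `Σ_{p ≤ M} 1/p ≤ log log M + 4`, tree `MertensBound.sum_inv_prime_le`)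
gives `Σ_{1 ≤ m ≤ M} t^{s(m)} ≤ M·exp(2t(log log M + 4))`, and `log log((a+|b|)x) ≤ log log x + c₁`,
`c₁ = log(1 + log(a+|b|))` (as `log x ≥ 1`).  Finally `log log x ≥ log log 3 > 0` absorbs every
additive constant into `C·t·log log x`.

References: R. R. Hall, G. Tenenbaum, *Divisors*, Cambridge Tracts in Math. 90 (1988), (0.4).
-/

namespace Summit.Parity.BatemanHorn.Cruxes.SystemZeroRepulsion.SmoothRoughLatticeAcquisition

open Finset Real Polynomial
open Summit.Parity.BatemanHorn.Cruxes.LinearCappedRepulsion.JensenStieltjesMajorant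
  (capped_prime_pow capped_mul_of_coprime hasSum_localFactor tsum_localFactor_le loglog_nonneg)

/-- Rankin's trick for the capped statistic, all tilts `y ≥ 0`:
`Σ_{1 ≤ m ≤ M} y^{s(m)} ≤ M·exp(2y(log log M + 4))` for `M ≥ 2`. -/
private theorem farLin_rankin {M : ℕ} (hM : 2 ≤ M) {y : ℝ} (hy : 0 ≤ y) :
    ∑ m ∈ Icc 1 M, y ^ (m.factorization.sum fun _ v => min v 2) ≤
      (M : ℝ) * Real.exp (2 * y * (Real.log (Real.log (M : ℝ)) + 4)) := by
  -- adapted from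
  -- Summits/Parity/BatemanHorn/Theorems/AlmostPrimeZerosLinearCappedRepulsionRankinMajorant.lean
  set f : ℕ → ℝ := fun n => y ^ (n.factorization.sum fun _ v => min v 2) with hf
  have hf0 : ∀ n, 0 ≤ f n := fun n => pow_nonneg hy _
  have hf1 : f 1 = 1 := by simp [hf]
  have hmul : ∀ m n, Nat.Coprime m n → f (m * n) = f m * f n := by
    intro m n hmn
    simp only [hf]
    rw [capped_mul_of_coprime hmn, pow_add]
  have hfun : ∀ {p : ℕ}, p.Prime →
      (fun ν : ℕ => f (p ^ ν) / (p : ℝ) ^ ν) = fun ν : ℕ => y ^ (min ν 2) / (p : ℝ) ^ ν := by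
    intro p hp
    funext ν
    simp only [hf]
    rw [capped_prime_pow hp]
  have hsum : ∀ p : ℕ, p.Prime → Summable (fun ν : ℕ => f (p ^ ν) / (p : ℝ) ^ ν) := by
    intro p hp
    rw [hfun hp]
    exact (hasSum_localFactor hp y).summable
  have hM0 : (0 : ℝ) ≤ M := by positivity
  set L : ℝ := Real.log (Real.log (M : ℝ)) with hLdef
  have hMert : ∑ p ∈ Nat.primesLE M, (1 : ℝ) / p ≤ L + 4 :=
    Literature.NumberTheory.LFunctions.MertensBound.sum_inv_prime_le M hM
  have hprod : ∏ p ∈ Nat.primesLE M, ∑' ν : ℕ, f (p ^ ν) / (p : ℝ) ^ ν ≤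
      Real.exp (2 * y * (L + 4)) := by
    have hmem : ∀ p ∈ Nat.primesLE M, p.Prime := fun p hp => (Nat.mem_primesLE.mp hp).2
    calc ∏ p ∈ Nat.primesLE M, ∑' ν : ℕ, f (p ^ ν) / (p : ℝ) ^ ν
        ≤ ∏ p ∈ Nat.primesLE M, Real.exp (2 * y / p) := by
          refine Finset.prod_le_prod (fun p _ => tsum_nonneg fun ν => ?_) fun p hp => ?_
          · exact div_nonneg (hf0 _) (pow_nonneg (Nat.cast_nonneg _) _)
          · rw [hfun (hmem p hp)]
            exact tsum_localFactor_le (hmem p hp) hy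
      _ = Real.exp (∑ p ∈ Nat.primesLE M, 2 * y / p) := (Real.exp_sum _ _).symm
      _ ≤ Real.exp (2 * y * (L + 4)) := by
          refine Real.exp_le_exp.mpr ?_
          have e : ∑ p ∈ Nat.primesLE M, 2 * y / (p : ℝ)
              = 2 * y * ∑ p ∈ Nat.primesLE M, (1 : ℝ) / p := by
            rw [Finset.mul_sum]
            refine Finset.sum_congr rfl fun p _ => ?_
            ring
          rw [e]
          exact mul_le_mul_of_nonneg_left hMert (by positivity)
  change ∑ n ∈ Icc 1 M, f n ≤ _
  calc ∑ n ∈ Icc 1 M, f n ≤ ∑ n ∈ Icc 1 M, (M : ℝ) * (f n / n) := by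
        refine Finset.sum_le_sum fun n hn => ?_
        have hn1 : (1 : ℝ) ≤ n := by exact_mod_cast (Finset.mem_Icc.mp hn).1
        have hnx : (n : ℝ) ≤ M := by exact_mod_cast (Finset.mem_Icc.mp hn).2
        have hn0 : (0 : ℝ) < n := by linarith
        calc f n = (n : ℝ) * (f n / n) := by field_simp
          _ ≤ (M : ℝ) * (f n / n) :=
              mul_le_mul_of_nonneg_right hnx (div_nonneg (hf0 n) hn0.le)
    _ = M * ∑ n ∈ Icc 1 M, f n / n := by rw [Finset.mul_sum]
    _ ≤ M * ∏ p ∈ Nat.primesLE M, ∑' ν : ℕ, f (p ^ ν) / (p : ℝ) ^ ν :=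
        mul_le_mul_of_nonneg_left
          (Literature.NumberTheory.LFunctions.HallTenenbaum.sum_div_le_prod_tsum
            hf1 hmul hf0 hsum M) hM0
    _ ≤ M * Real.exp (2 * y * (L + 4)) := mul_le_mul_of_nonneg_left hprod hM0

/-- Re-indexing along a linear polynomial `a n + b`, `a > 0`, `x ≥ 1`: the `n ≤ x` with
`a n + b ≤ 0` contribute `y^{s(0)} = 1` each, and `n ↦ a n + b` maps the others injectively into
`[1, (a + |b|)·x]`. -/
private theorem farLin_reindex {a b : ℤ} (ha : 0 < a) {x : ℕ} (hx : 1 ≤ x) {y : ℝ} (hy : 0 ≤ y) :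
    ∑ n ∈ range (x + 1), y ^ ((a * n + b).toNat.factorization.sum fun _ v => min v 2) ≤
      ((x : ℝ) + 1) +
        ∑ m ∈ Icc 1 ((a.toNat + b.natAbs) * x), y ^ (m.factorization.sum fun _ v => min v 2) := by
  classical
  set F : ℕ → ℝ := fun m => y ^ (m.factorization.sum fun _ v => min v 2) with hF
  have hF0 : ∀ m, 0 ≤ F m := fun m => pow_nonneg hy _
  set φ : ℕ → ℕ := fun n => (a * n + b).toNat with hφ
  set S := range (x + 1) with hS
  change ∑ n ∈ S, F (φ n) ≤ ((x : ℝ) + 1) + ∑ m ∈ Icc 1 ((a.toNat + b.natAbs) * x), F m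
  rw [← Finset.sum_filter_add_sum_filter_not S (fun n : ℕ => 0 < a * (n : ℤ) + b)]
  -- the non-positive values: each term is `1`
  have hneg : ∑ n ∈ S.filter (fun n : ℕ => ¬ 0 < a * (n : ℤ) + b), F (φ n) ≤ (x : ℝ) + 1 := by
    have h1 : ∀ n ∈ S.filter (fun n : ℕ => ¬ 0 < a * (n : ℤ) + b), F (φ n) = 1 := by
      intro n hn
      have hn := (Finset.mem_filter.mp hn).2
      have h0 : φ n = 0 := by
        simp only [hφ]
        exact Int.toNat_eq_zero.mpr (not_lt.mp hn)
      simp [hF, h0]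
    rw [Finset.sum_congr rfl h1, Finset.sum_const, nsmul_eq_mul, mul_one]
    have hc : ((S.filter (fun n : ℕ => ¬ 0 < a * (n : ℤ) + b)).card : ℝ) ≤ (S.card : ℝ) := by
      exact_mod_cast Finset.card_filter_le _ _
    simpa [hS] using hc
  -- the positive values: injective re-indexing into `[1, (a + |b|) x]`
  have hpos : ∑ n ∈ S.filter (fun n : ℕ => 0 < a * (n : ℤ) + b), F (φ n) ≤
      ∑ m ∈ Icc 1 ((a.toNat + b.natAbs) * x), F m := by
    have hinj : ∀ n₁ ∈ S.filter (fun n : ℕ => 0 < a * (n : ℤ) + b),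
        ∀ n₂ ∈ S.filter (fun n : ℕ => 0 < a * (n : ℤ) + b), φ n₁ = φ n₂ → n₁ = n₂ := by
      intro n₁ hn₁ n₂ hn₂ h
      have h₁ := (Finset.mem_filter.mp hn₁).2
      have h₂ := (Finset.mem_filter.mp hn₂).2
      have h' : ((φ n₁ : ℕ) : ℤ) = ((φ n₂ : ℕ) : ℤ) := by rw [h]
      have e₁ : ((φ n₁ : ℕ) : ℤ) = a * n₁ + b := by
        simp only [hφ]; exact Int.toNat_of_nonneg h₁.le
      have e₂ : ((φ n₂ : ℕ) : ℤ) = a * n₂ + b := by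
        simp only [hφ]; exact Int.toNat_of_nonneg h₂.le
      have h'' : (a * n₁ : ℤ) = a * n₂ := by linarith
      exact_mod_cast mul_left_cancel₀ ha.ne' h''
    rw [← Finset.sum_image hinj]
    refine Finset.sum_le_sum_of_subset_of_nonneg ?_ fun m _ _ => hF0 m
    intro m hm
    obtain ⟨n, hn, rfl⟩ := Finset.mem_image.mp hm
    have hnS := Finset.mem_range.mp (Finset.mem_filter.mp hn).1
    have hnp := (Finset.mem_filter.mp hn).2
    have hnx : (n : ℤ) ≤ x := by exact_mod_cast Nat.lt_succ_iff.mp hnS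
    refine Finset.mem_Icc.mpr ⟨?_, ?_⟩
    · exact Int.lt_toNat.mpr (by simpa using hnp)
    · refine Int.toNat_le.mpr ?_
      have hcast : (((a.toNat + b.natAbs) * x : ℕ) : ℤ) = (a + |b|) * x := by
        push_cast
        rw [Int.toNat_of_nonneg ha.le]
      rw [hcast]
      have hx1 : (1 : ℤ) ≤ x := by exact_mod_cast hx
      have hb : b ≤ |b| := le_abs_self b
      have hb0 : 0 ≤ |b| := abs_nonneg b
      nlinarith
  linarith

/-- `1 < log 3` (since `e < 2.72 < 3`). -/
private theorem farLin_one_lt_log_three : 1 < Real.log 3 := by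
  rw [Real.lt_log_iff_exp_lt (by norm_num)]
  have := Real.exp_one_lt_d9
  linarith

/-- **Far moment along a LINEAR system** (stub S1 `stub_farMoment` for `k ≤ 1`, `deg ≤ 1`, and
then for every tilt `t ≥ 1`): for a Bateman–Horn system with at most one member, of degree `≤ 1`,
there is `C` with `Σ_{0 ≤ n ≤ x} t^{s_f(n)} ≤ (x + 1)·exp(C·t·log log x)` for all `x ≥ 3`, `t ≥ 1`. -/
theorem farMoment_linear :
    ∀ (k : ℕ) (f : Fin k → Polynomial ℤ), Literature.NumberTheory.Sieve.IsBatemanHornSystem f →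
      k ≤ 1 → (∀ i, (f i).natDegree ≤ 1) →
      ∃ C : ℝ, ∀ x : ℕ, 3 ≤ x → ∀ t : ℝ, 1 ≤ t →
        (∑ n ∈ Finset.range (x + 1), (t : ℝ) ^ (∑ i, (((f i).eval (n : ℤ)).toNat.factorization.sum fun _ v => min v 2))) ≤
          ((x : ℝ) + 1) * Real.exp (C * t * Real.log (Real.log (x : ℝ))) := by
  intro k f hf hk hdeg
  rcases Nat.le_one_iff_eq_zero_or_eq_one.mp hk with rfl | rfl
  · refine ⟨0, fun x _ t _ => ?_⟩
    simp
  -- `k = 1`: `f 0 = a X + b`, `a > 0`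
  have hd1 : (f 0).natDegree = 1 := le_antisymm (hdeg 0) (hf.natDegree_pos 0)
  have hg := Polynomial.eq_X_add_C_of_natDegree_le_one (hdeg 0)
  set a : ℤ := (f 0).coeff 1 with ha_def
  set b : ℤ := (f 0).coeff 0 with hb_def
  have ha : 0 < a := by
    have h := hf.leadingCoeff_pos 0
    rwa [Polynomial.leadingCoeff, hd1] at h
  have heval : ∀ n : ℕ, (f 0).eval (n : ℤ) = a * n + b := by
    intro n
    conv_lhs => rw [hg]
    simp
  -- constants
  set A : ℕ := a.toNat + b.natAbs with hA_def
  have hA1 : (1 : ℝ) ≤ A := by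
    have h1 : 1 ≤ a.toNat := by
      have : (1 : ℤ) ≤ a := ha
      omega
    have : 1 ≤ A := le_trans h1 (Nat.le_add_right _ _)
    exact_mod_cast this
  have hA0 : (0 : ℝ) < A := by linarith
  set c₁ : ℝ := Real.log (1 + Real.log A) with hc₁_def
  have hlogA : 0 ≤ Real.log A := Real.log_nonneg hA1
  have hc₁ : 0 ≤ c₁ := Real.log_nonneg (by linarith)
  set c₂ : ℝ := 2 * c₁ + 8 + Real.log (2 * A) with hc₂_def
  have hlog2A : 0 ≤ Real.log (2 * A) := Real.log_nonneg (by linarith)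
  have hc₂ : 0 ≤ c₂ := by positivity
  set L₀ : ℝ := Real.log (Real.log 3) with hL₀_def
  have hL₀ : 0 < L₀ := Real.log_pos farLin_one_lt_log_three
  refine ⟨2 + c₂ / L₀, fun x hx t ht => ?_⟩
  have ht0 : 0 ≤ t := by linarith
  have hx3 : (3 : ℝ) ≤ x := by exact_mod_cast hx
  have hx0 : (0 : ℝ) < x := by linarith
  have hx1 : 1 ≤ x := by omega
  set L : ℝ := Real.log (Real.log (x : ℝ)) with hL_def
  have hlog3x : Real.log 3 ≤ Real.log x := Real.log_le_log (by norm_num) hx3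
  have hlogx1 : 1 ≤ Real.log x := le_trans farLin_one_lt_log_three.le hlog3x
  have hLL₀ : L₀ ≤ L := Real.log_le_log (by linarith [farLin_one_lt_log_three]) hlog3x
  have hL0 : 0 ≤ L := hL₀.le.trans hLL₀
  -- Step 1: rewrite the statistic along `f 0 = aX + b` and re-index
  have hsum_eq : ∀ n : ℕ,
      (t : ℝ) ^ (∑ i : Fin 1, (((f i).eval (n : ℤ)).toNat.factorization.sum fun _ v => min v 2)) =
        t ^ ((a * n + b).toNat.factorization.sum fun _ v => min v 2) := by
    intro n
    rw [Fin.sum_univ_one, heval n]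
  rw [Finset.sum_congr rfl fun n _ => hsum_eq n]
  set M : ℕ := A * x with hM_def
  have hM3 : 3 ≤ M := by
    have h1 : 1 ≤ A := by exact_mod_cast hA1
    calc 3 ≤ x := hx
      _ = 1 * x := (one_mul x).symm
      _ ≤ A * x := Nat.mul_le_mul_right x h1
  have hMreal : (M : ℝ) = (A : ℝ) * x := by rw [hM_def]; push_cast; ring
  have hstep1 := farLin_reindex (b := b) ha hx1 ht0
  have hstep2 := farLin_rankin (M := M) (by omega) ht0
  -- Step 2: `log log M ≤ L + c₁`
  have hlogM : Real.log (M : ℝ) ≤ (1 + Real.log A) * Real.log x := by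
    rw [hMreal, Real.log_mul hA0.ne' hx0.ne']
    have : Real.log A ≤ Real.log A * Real.log x := le_mul_of_one_le_right hlogA hlogx1
    linarith
  have hM3r : (3 : ℝ) ≤ M := by exact_mod_cast hM3
  have hlogMpos : 0 < Real.log (M : ℝ) := by
    have := Real.log_le_log (by norm_num) hM3r
    linarith [farLin_one_lt_log_three]
  have hloglogM : Real.log (Real.log (M : ℝ)) ≤ L + c₁ := by
    calc Real.log (Real.log (M : ℝ)) ≤ Real.log ((1 + Real.log A) * Real.log x) :=
          Real.log_le_log hlogMpos hlogM
      _ = c₁ + L := by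
          rw [Real.log_mul (by linarith) (by linarith)]
      _ = L + c₁ := add_comm _ _
  -- Step 3: assemble
  have hE : Real.exp (2 * t * (Real.log (Real.log (M : ℝ)) + 4)) ≤
      Real.exp (2 * t * (L + c₁ + 4)) := by
    refine Real.exp_le_exp.mpr ?_
    have : Real.log (Real.log (M : ℝ)) + 4 ≤ L + c₁ + 4 := by linarith
    exact mul_le_mul_of_nonneg_left this (by positivity)
  have hexp1 : 1 ≤ Real.exp (2 * t * (L + c₁ + 4)) := Real.one_le_exp (by positivity)
  have hAexp : 1 ≤ (A : ℝ) * Real.exp (2 * t * (L + c₁ + 4)) := by nlinarith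
  have hfinal : ((x : ℝ) + 1) + (M : ℝ) * Real.exp (2 * t * (Real.log (Real.log (M : ℝ)) + 4)) ≤
      ((x : ℝ) + 1) * Real.exp ((2 + c₂ / L₀) * t * L) := by
    calc ((x : ℝ) + 1) + (M : ℝ) * Real.exp (2 * t * (Real.log (Real.log (M : ℝ)) + 4))
        ≤ ((x : ℝ) + 1) + (A : ℝ) * ((x : ℝ) + 1) * Real.exp (2 * t * (L + c₁ + 4)) := by
          have h1 : (M : ℝ) ≤ (A : ℝ) * ((x : ℝ) + 1) := by rw [hMreal]; nlinarith
          have h2 : 0 ≤ Real.exp (2 * t * (Real.log (Real.log (M : ℝ)) + 4)) := by positivity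
          have h3 : (0 : ℝ) ≤ (A : ℝ) * ((x : ℝ) + 1) := by positivity
          linarith [mul_le_mul h1 hE h2 h3]
      _ = ((x : ℝ) + 1) * (1 + (A : ℝ) * Real.exp (2 * t * (L + c₁ + 4))) := by ring
      _ ≤ ((x : ℝ) + 1) * (2 * (A : ℝ) * Real.exp (2 * t * (L + c₁ + 4))) := by
          refine mul_le_mul_of_nonneg_left ?_ (by positivity)
          linarith
      _ = ((x : ℝ) + 1) * Real.exp (Real.log (2 * A) + 2 * t * (L + c₁ + 4)) := by
          rw [Real.exp_add, Real.exp_log (by positivity)]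
      _ ≤ ((x : ℝ) + 1) * Real.exp ((2 + c₂ / L₀) * t * L) := by
          refine mul_le_mul_of_nonneg_left (Real.exp_le_exp.mpr ?_) (by positivity)
          -- `log(2A) + 2t(L + c₁ + 4) ≤ 2tL + t c₂ ≤ 2tL + t c₂ L/L₀`
          have h1 : Real.log (2 * A) ≤ t * Real.log (2 * A) := le_mul_of_one_le_left hlog2A ht
          have h2 : t * c₂ ≤ t * (c₂ / L₀ * L) := by
            refine mul_le_mul_of_nonneg_left ?_ ht0
            rw [div_mul_eq_mul_div, le_div_iff₀ hL₀]
            exact mul_le_mul_of_nonneg_left hLL₀ hc₂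
          have h3 : Real.log (2 * A) + 2 * t * (L + c₁ + 4) = 2 * t * L + t * c₂ - (t - 1) * Real.log (2 * A) := by
            simp only [hc₂_def]; ring
          nlinarith
  exact le_trans (le_trans hstep1 (by linarith)) hfinal

/-- The registered S1 shape (`stub_farMoment`, with the tilt window `1 ≤ t ≤ √log x`) for the
linear systems `k ≤ 1`, `deg f₀ ≤ 1`; the upper constraint on `t` is simply not needed. -/
theorem farMoment_linear_capped :
    ∀ (k : ℕ) (f : Fin k → Polynomial ℤ), Literature.NumberTheory.Sieve.IsBatemanHornSystem f →
      k ≤ 1 → (∀ i, (f i).natDegree ≤ 1) →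
      ∃ C : ℝ, ∀ x : ℕ, 3 ≤ x → ∀ t : ℝ, 1 ≤ t → t ≤ Real.sqrt (Real.log (x : ℝ)) →
        (∑ n ∈ Finset.range (x + 1), (t : ℝ) ^ (∑ i, (((f i).eval (n : ℤ)).toNat.factorization.sum fun _ v => min v 2))) ≤
          ((x : ℝ) + 1) * Real.exp (C * t * Real.log (Real.log (x : ℝ))) := by
  intro k f hf hk hdeg
  obtain ⟨C, hC⟩ := farMoment_linear k f hf hk hdeg
  exact ⟨C, fun x hx t ht _ => hC x hx t ht⟩

/-- **The reshaped far moment S1′ (`stub_farMomentWide`) for the linear systems** (`k ≤ 1`, `deg f₀ ≤ 1`): the S1′ budget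
`exp(C·(t·log log x + t²/log log x))` dominates the linear bound `exp(C·t·log log x)` (`t²/log log x ≥ 0` for `x ≥ 3`), so
`farMoment_linear` gives S1′ verbatim under the two extra hypotheses, for the whole window `1 ≤ t ≤ √log x`. -/
theorem stub_farMomentWide_linear :
    ∀ (k : ℕ) (f : Fin k → Polynomial ℤ), Literature.NumberTheory.Sieve.IsBatemanHornSystem f →
      k ≤ 1 → (∀ i, (f i).natDegree ≤ 1) →
      ∃ C : ℝ, ∀ x : ℕ, 3 ≤ x → ∀ t : ℝ, 1 ≤ t → t ≤ Real.sqrt (Real.log (x : ℝ)) →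
        (∑ n ∈ Finset.range (x + 1), (t : ℝ) ^ (∑ i, (((f i).eval (n : ℤ)).toNat.factorization.sum fun _ v => min v 2))) ≤
          ((x : ℝ) + 1) * Real.exp (C * (t * Real.log (Real.log (x : ℝ)) + t ^ 2 / Real.log (Real.log (x : ℝ)))) := by
  intro k f hf hk hdeg
  obtain ⟨C, hC⟩ := farMoment_linear k f hf hk hdeg
  refine ⟨max C 0, fun x hx t ht _ => (hC x hx t ht).trans ?_⟩
  have hx3 : (3 : ℝ) ≤ x := by exact_mod_cast hx
  have hL : 0 ≤ Real.log (Real.log (x : ℝ)) := by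
    have h1 : 1 < Real.log (x : ℝ) := farLin_one_lt_log_three.trans_le (Real.log_le_log (by norm_num) hx3)
    exact Real.log_nonneg h1.le
  refine mul_le_mul_of_nonneg_left (Real.exp_le_exp.mpr ?_) (by positivity)
  have ht0 : 0 ≤ t := by linarith
  have h1 : C * t * Real.log (Real.log (x : ℝ)) ≤ max C 0 * (t * Real.log (Real.log (x : ℝ))) := by
    rw [mul_assoc]
    exact mul_le_mul_of_nonneg_right (le_max_left _ _) (mul_nonneg ht0 hL)
  have h2 : 0 ≤ max C 0 * (t ^ 2 / Real.log (Real.log (x : ℝ))) :=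
    mul_nonneg (le_max_right _ _) (div_nonneg (sq_nonneg t) hL)
  nlinarith [h1, h2]

end Summit.Parity.BatemanHorn.Cruxes.SystemZeroRepulsion.SmoothRoughLatticeAcquisition
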